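import Summits.KontsevichZagierPeriods.KontsevichZagierPeriods.Theorems.LinRedNormalFormArrangementNormalFormSeparateTwoComparison
import Literature.NumberTheory.Transcendental.KZProduct

/-!
# The fibre mass of a literal Janus band datum: Tonelli dictionary

(Line `janus-bands`, crux `ArrangementNormalForm`, stub `stub_separateTwo`, part `Mass`.)
Connects the literal classes of the skeleton (base dimension `B`, `k` fibres: base point
`x = (z (Fin.castAdd k i))ᵢ`, fibre point `t = (z (Fin.natAdd B j))ⱼ`, rational affine atoms
`c = (c.1, c.2)` with value `av x c = ∑ c.1 i xᵢ + c.2`, bounds `lo, hi`, letters `a`) with the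
abstract fibre mass `SepTwo.lmass` of part `Comparison`: the literal domain is
`fdom Y lo hi = {z | x ∈ Y, t ∈ cell lo hi (av x)}`, the literal letter block `rblock a z` has
`ofReal |rblock a z| = lblock a (av x) t`, and TONELLI along `ℝ^{B+k} ≅ ℝ^B × ℝ^k`
(`KZ.appendMeasurableEquiv`) gives
`∫⁻_{fdom Y} g(x) |rblock| dz = ∫⁻_{x ∈ Y} g(x) · lmass lo hi a (av x) dx` (`lintegral_fdom`,
registered in literal form as `separateTwo_mass`), whence the integrability criterion
`integrableOn_fdom_iff`: `R(x) · rblock` is absolutely integrable on the literal domain iff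
`∫⁻_Y |R| · lmass < ∞`. This is how fibre-mass comparisons become (termwise) absolute convergence
statements for the representations of `stub_separateTwo`.
-/

noncomputable section

open Set MeasureTheory
open scoped ENNReal

namespace Summit.KontsevichZagierPeriods.ArrangementNormalForm.JanusBands

namespace SepTwo

open Literature.NumberTheory.Transcendental

variable {B k : ℕ}

/-- Rational affine atoms over a base of dimension `B` (the literal type of the skeleton). -/
abbrev Atm (B : ℕ) := (Fin B → ℚ) × ℚ

/-- Value of an atom at a base point. -/
def av (x : Fin B → ℝ) (c : Atm B) : ℝ := ∑ i, (c.1 i : ℝ) * x i + (c.2 : ℝ)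

/-- The base point of `z ∈ ℝ^{B+k}`. -/
def basePt (z : Fin (B + k) → ℝ) : Fin B → ℝ := fun i => z (Fin.castAdd k i)

/-- The fibre point of `z ∈ ℝ^{B+k}`. -/
def fibPt (z : Fin (B + k) → ℝ) : Fin k → ℝ := fun j => z (Fin.natAdd B j)

/-- The literal (real-valued) letter block. -/
def rblock (a : Fin k → Option (Atm B)) (z : Fin (B + k) → ℝ) : ℝ :=
  ∏ i, (a i).elim 1 (fun c => 1 / (fibPt z i - av (basePt z) c))

/-- The literal domain over a base set `Y`. -/
def fdom (Y : Set (Fin B → ℝ)) (lo hi : Fin k → Fin k ⊕ Atm B) : Set (Fin (B + k) → ℝ) :=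
  {z | basePt z ∈ Y ∧ fibPt z ∈ cell lo hi (av (basePt z))}

/-- `basePt (Fin.append x t) = x`. -/
@[simp] theorem basePt_append (x : Fin B → ℝ) (t : Fin k → ℝ) : basePt (Fin.append x t) = x :=
  funext fun i => Fin.append_left x t i

/-- `fibPt (Fin.append x t) = t`. -/
@[simp] theorem fibPt_append (x : Fin B → ℝ) (t : Fin k → ℝ) : fibPt (Fin.append x t) = t :=
  funext fun j => Fin.append_right x t j

/-- The literal letter block and the abstract one. -/
theorem ofReal_abs_rblock (a : Fin k → Option (Atm B)) (z : Fin (B + k) → ℝ) :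
    ENNReal.ofReal |rblock a z| = lblock a (av (basePt z)) (fibPt z) := by
  unfold rblock lblock
  rw [Finset.abs_prod, ENNReal.ofReal_prod_of_nonneg fun i _ => abs_nonneg _]
  refine Finset.prod_congr rfl fun i _ => ?_
  rcases a i with _ | c
  · simp
  · simp [abs_inv]

/-- Atom values are measurable in the base point. -/
theorem measurable_av (c : Atm B) : Measurable fun x : Fin B → ℝ => av x c := by
  unfold av
  refine Measurable.add_const (Finset.measurable_sum _ fun i _ => ?_) _
  exact (measurable_pi_apply i).const_mul _

/-- Bound values are jointly measurable on `ℝ^B × ℝ^k`. -/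
theorem measurable_elim_prod (u : Fin k ⊕ Atm B) :
    Measurable fun p : (Fin B → ℝ) × (Fin k → ℝ) => Sum.elim p.2 (av p.1) u := by
  cases u with
  | inl j => exact (measurable_pi_apply j).comp measurable_snd
  | inr c => exact (measurable_av c).comp measurable_fst

/-- The abstract letter block is jointly measurable on `ℝ^B × ℝ^k`. -/
theorem measurable_lblock_prod (a : Fin k → Option (Atm B)) :
    Measurable fun p : (Fin B → ℝ) × (Fin k → ℝ) => lblock a (av p.1) p.2 := by
  unfold lblock
  refine Finset.measurable_prod _ fun i _ => ?_
  rcases a i with _ | c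
  · exact measurable_const
  · simp only [Option.elim_some]
    have hm : Measurable fun p : (Fin B → ℝ) × (Fin k → ℝ) => p.2 i - av p.1 c :=
      ((measurable_pi_apply i).comp measurable_snd).sub ((measurable_av c).comp measurable_fst)
    exact ENNReal.measurable_ofReal.comp (continuous_abs.measurable.comp hm).inv

/-- The abstract letter block is measurable in the fibre point. -/
theorem measurable_lblock {ι : Type*} (a : Fin k → Option ι) (α : ι → ℝ) :
    Measurable fun t : Fin k → ℝ => lblock a α t := by
  unfold lblock
  refine Finset.measurable_prod _ fun i _ => ?_
  rcases a i with _ | c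
  · exact measurable_const
  · simp only [Option.elim_some]
    have hm : Measurable fun t : Fin k → ℝ => t i - α c := (measurable_pi_apply i).sub_const _
    exact ENNReal.measurable_ofReal.comp (continuous_abs.measurable.comp hm).inv

/-- The product form of the literal domain is measurable. -/
theorem measurableSet_pdom {Y : Set (Fin B → ℝ)} (hY : MeasurableSet Y) (lo hi : Fin k → Fin k ⊕ Atm B) :
    MeasurableSet {p : (Fin B → ℝ) × (Fin k → ℝ) | p.1 ∈ Y ∧ p.2 ∈ cell lo hi (av p.1)} := by
  have : {p : (Fin B → ℝ) × (Fin k → ℝ) | p.1 ∈ Y ∧ p.2 ∈ cell lo hi (av p.1)} =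
      Prod.fst ⁻¹' Y ∩ ⋂ i, ({p | Sum.elim p.2 (av p.1) (lo i) < p.2 i} ∩
        {p | p.2 i < Sum.elim p.2 (av p.1) (hi i)}) := by
    ext p; simp [cell]
  rw [this]
  refine (measurable_fst hY).inter (MeasurableSet.iInter fun i => ?_)
  exact (measurableSet_lt (measurable_elim_prod (lo i)) ((measurable_pi_apply i).comp measurable_snd)).inter
    (measurableSet_lt ((measurable_pi_apply i).comp measurable_snd) (measurable_elim_prod (hi i)))

/-- **Tonelli for the fibre mass.** See the module docstring. -/
theorem lintegral_fdom {Y : Set (Fin B → ℝ)} (hY : MeasurableSet Y) (lo hi : Fin k → Fin k ⊕ Atm B)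
    (a : Fin k → Option (Atm B)) (g : (Fin B → ℝ) → ℝ≥0∞) (hg : Measurable g) :
    ∫⁻ z in fdom Y lo hi, g (basePt z) * ENNReal.ofReal |rblock a z| =
      ∫⁻ x in Y, g x * lmass lo hi a (av x) := by
  set e := KZ.appendMeasurableEquiv B k with he
  set E := {p : (Fin B → ℝ) × (Fin k → ℝ) | p.1 ∈ Y ∧ p.2 ∈ cell lo hi (av p.1)} with hE
  set G : (Fin B → ℝ) × (Fin k → ℝ) → ℝ≥0∞ := fun p => g p.1 * lblock a (av p.1) p.2 with hG
  have hEm : MeasurableSet E := measurableSet_pdom hY lo hi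
  have hGm : Measurable G := (hg.comp measurable_fst).mul (measurable_lblock_prod a)
  have hpre : e ⁻¹' fdom Y lo hi = E := by
    ext p; simp [he, fdom, hE]
  have himg : e '' (e ⁻¹' fdom Y lo hi) = fdom Y lo hi := e.toEquiv.image_preimage _
  have h1 := (KZ.volume_preserving_appendMeasurableEquiv (n := B) (m := k)).setLIntegral_comp_emb
    e.measurableEmbedding (fun z => g (basePt z) * ENNReal.ofReal |rblock a z|) (e ⁻¹' fdom Y lo hi)
  rw [himg] at h1
  rw [← h1, hpre]
  have h2 : (fun p => g (basePt (e p)) * ENNReal.ofReal |rblock a (e p)|) = G := by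
    funext p; simp [he, hG, ofReal_abs_rblock]
  rw [h2, Measure.volume_eq_prod, ← lintegral_indicator hEm,
    lintegral_prod _ (hGm.indicator hEm).aemeasurable, ← lintegral_indicator hY]
  refine lintegral_congr fun x => ?_
  by_cases hx : x ∈ Y
  · rw [indicator_of_mem hx]
    have h3 : (fun t => E.indicator G (x, t)) =
        (cell lo hi (av x)).indicator fun t => g x * lblock a (av x) t := by
      funext t
      by_cases ht : t ∈ cell lo hi (av x)
      · rw [indicator_of_mem (show (x, t) ∈ E from ⟨hx, ht⟩), indicator_of_mem ht]
      · rw [indicator_of_notMem (show (x, t) ∉ E from fun h => ht h.2), indicator_of_notMem ht]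
    rw [h3, lintegral_indicator (measurableSet_cell lo hi _)]
    exact lintegral_const_mul (g x) (measurable_lblock a (av x))
  · rw [indicator_of_notMem hx]
    have h3 : ∀ t, E.indicator G (x, t) = 0 := fun t => indicator_of_notMem (fun h => hx h.1) _
    simp [h3]

/-- **Integrability criterion.** A function that agrees on the literal domain with
`R(base) · (letter block)`, for a measurable `R`, is absolutely integrable there iff
`∫⁻_Y |R| · lmass < ∞`. -/
theorem integrableOn_fdom_iff {Y : Set (Fin B → ℝ)} (hY : MeasurableSet Y)
    (lo hi : Fin k → Fin k ⊕ Atm B) (a : Fin k → Option (Atm B)) (R : (Fin B → ℝ) → ℝ)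
    (hR : Measurable R) (f : (Fin (B + k) → ℝ) → ℝ)
    (hf : EqOn f (fun z => R (basePt z) * rblock a z) (fdom Y lo hi))
    (hfm : AEStronglyMeasurable f (volume.restrict (fdom Y lo hi))) :
    IntegrableOn f (fdom Y lo hi) ↔
      ∫⁻ x in Y, ENNReal.ofReal |R x| * lmass lo hi a (av x) < ∞ := by
  have hDm : MeasurableSet (fdom Y lo hi) := by
    have h := (measurableSet_pdom hY lo hi).preimage (KZ.appendMeasurableEquiv B k).symm.measurable
    convert h using 1
    ext z
    simp only [fdom, mem_setOf_eq, mem_preimage, KZ.appendMeasurableEquiv_symm_apply]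
    exact Iff.rfl
  have h4 := lintegral_fdom hY lo hi a (fun x => ENNReal.ofReal |R x|)
    (ENNReal.measurable_ofReal.comp (continuous_abs.measurable.comp hR))
  beta_reduce at h4
  have h5 : ∫⁻ z in fdom Y lo hi, ENNReal.ofReal ‖f z‖ =
      ∫⁻ z in fdom Y lo hi, ENNReal.ofReal |R (basePt z)| * ENNReal.ofReal |rblock a z| :=
    setLIntegral_congr_fun hDm fun z hz => by
      rw [Real.norm_eq_abs, hf hz]
      beta_reduce
      rw [abs_mul, ENNReal.ofReal_mul (abs_nonneg _)]
  rw [IntegrableOn, Integrable, and_iff_right hfm, hasFiniteIntegral_iff_norm, h5, h4]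

/-- The literal domain text of the skeleton is `fdom`. -/
theorem literal_dom {m' : ℕ} (M : Fin m' → Atm B) (lo hi : Fin k → Fin k ⊕ Atm B) :
    {z : Fin (B + k) → ℝ | (∀ j, 0 < ∑ i, ((M j).1 i : ℝ) * z (Fin.castAdd k i) + ((M j).2 : ℝ)) ∧
      ∀ i, Sum.elim (fun j => z (Fin.natAdd B j))
        (fun c => ∑ i', (c.1 i' : ℝ) * z (Fin.castAdd k i') + (c.2 : ℝ)) (lo i) < z (Fin.natAdd B i) ∧
        z (Fin.natAdd B i) < Sum.elim (fun j => z (Fin.natAdd B j))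
          (fun c => ∑ i', (c.1 i' : ℝ) * z (Fin.castAdd k i') + (c.2 : ℝ)) (hi i)} =
      fdom {x | ∀ j, 0 < av x (M j)} lo hi := rfl

/-- The literal letter block text of the skeleton is `rblock`. -/
theorem literal_rblock (a : Fin k → Option (Atm B)) (z : Fin (B + k) → ℝ) :
    (∏ i, (a i).elim 1 (fun c => 1 / (z (Fin.natAdd B i) -
      (∑ i', (c.1 i' : ℝ) * z (Fin.castAdd k i') + (c.2 : ℝ))))) = rblock a z := rfl

end SepTwo

/-- **Tonelli for the fibre mass of a literal Janus band datum** (registered sub-goal of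
`stub_separateTwo`; literal form of `SepTwo.lintegral_fdom`): over the literal domain with
base polyhedron `{∀ j, 0 < M_j}` and fibre bounds `lo, hi`, the lower integral of
`g(base) · |letter block|` is the base integral of `g · (fibre mass)`. -/
theorem separateTwo_mass (B k m' : ℕ) (M : Fin m' → (Fin B → ℚ) × ℚ) (lo hi : Fin k → Fin k ⊕ ((Fin B → ℚ) × ℚ)) (a : Fin k → Option ((Fin B → ℚ) × ℚ)) (g : (Fin B → ℝ) → ENNReal) (hg : Measurable g) : MeasureTheory.lintegral (MeasureTheory.volume.restrict {z : Fin (B + k) → ℝ | (∀ j, 0 < ∑ i, ((M j).1 i : ℝ) * z (Fin.castAdd k i) + ((M j).2 : ℝ)) ∧ ∀ i, Sum.elim (fun j => z (Fin.natAdd B j)) (fun c => ∑ i', (c.1 i' : ℝ) * z (Fin.castAdd k i') + (c.2 : ℝ)) (lo i) < z (Fin.natAdd B i) ∧ z (Fin.natAdd B i) < Sum.elim (fun j => z (Fin.natAdd B j)) (fun c => ∑ i', (c.1 i' : ℝ) * z (Fin.castAdd k i') + (c.2 : ℝ)) (hi i)}) (fun z => g (fun i => z (Fin.castAdd k i)) *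 ENNReal.ofReal |∏ i, (a i).elim 1 (fun c => 1 / (z (Fin.natAdd B i) - (∑ i', (c.1 i' : ℝ) * z (Fin.castAdd k i') + (c.2 : ℝ))))|) = MeasureTheory.lintegral (MeasureTheory.volume.restrict {x : Fin B → ℝ | ∀ j, 0 < ∑ i, ((M j).1 i : ℝ) * x i + ((M j).2 : ℝ)}) (fun x => g x * SepTwo.lmass lo hi a (fun c : (Fin B → ℚ) × ℚ => ∑ i, (c.1 i : ℝ) * x i + (c.2 : ℝ))) := by
  have hY : MeasurableSet {x : Fin B → ℝ | ∀ j, 0 < SepTwo.av x (M j)} := by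
    have : {x : Fin B → ℝ | ∀ j, 0 < SepTwo.av x (M j)} = ⋂ j, {x | 0 < SepTwo.av x (M j)} := by
      ext x; simp
    rw [this]
    exact MeasurableSet.iInter fun j => measurableSet_lt measurable_const (SepTwo.measurable_av _)
  exact SepTwo.lintegral_fdom hY lo hi a g hg

end Summit.KontsevichZagierPeriods.ArrangementNormalForm.JanusBands
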